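import Summits.ValiantsHypothesis.ValiantsHypothesis.Theses.MonotoneRestoration
import Literature.Computability.AlgebraicComplexity.RazElusiveGeneralRouteProofs
import Literature.ModelTheory.FiniteModelTheory.CkEquiv

/-!
# Sketch — crux-ideate stmt-ValiantsHypothesis-15886 (MonotoneRestorationQP), round 1, ideator 1

Scratch file (elaboration only). Contents:

* `target_implies_crux` — PROVED here: `NonnegRestorationQP → MonotoneRestorationQP`
  (a monotone circuit over ℝ≥0 is a circuit; `complexity_map_le`). Together with the route's
  PROVED `CruxToTarget` this shows the crux is EQUIVALENT to the target X: the monotone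
  hypothesis is logically removable (Hrubeš), it is only a proof STRATEGY.
* first-lemma signatures of the three idea cards:
  - card `row-multilinear-waring`: `IsRowMultilinear`, `RowMultilinearRestorationQP`,
    `alignedMatrix`, `AlignedRankQP`;
  - card `noninjective-core`: `nonInjPoly`, `NonInjMonotoneSuperpoly`, `CruxForcesNonInjHard`,
    `NonInjMonotoneExp`;
  - card `ck-fooling-lift`: `bipGraph`, `evalBool`, `MonotoneCkFooling`.
-/

noncomputable section

open scoped BigOperators
open MvPolynomial

namespace Summit.ValiantsHypothesis.ValiantsHypothesis.Cruxes.MonotoneRestorationQP.Sketch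

open Summit.ValiantsHypothesis.ValiantsHypothesis.Theses.MonotoneRestoration
open Literature.Computability.AlgebraicComplexity

/-! ### The crux is equivalent to the target -/

theorem pow_succ_two_bound (n c : ℕ) : (n + 2) ^ c ≤ n ^ (2 * c + 3 ^ c) + (2 * c + 3 ^ c) := by
  rcases Nat.lt_or_ge n 2 with hn | hn
  · -- n = 0 or n = 1: (n+2)^c ≤ 3^c
    have h3 : (n + 2) ^ c ≤ 3 ^ c := Nat.pow_le_pow_left (by omega) c
    calc (n + 2) ^ c ≤ 3 ^ c := h3
      _ ≤ 2 * c + 3 ^ c := Nat.le_add_left _ _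
      _ ≤ n ^ (2 * c + 3 ^ c) + (2 * c + 3 ^ c) := Nat.le_add_left _ _
  · have h1 : n + 2 ≤ n * n := by nlinarith
    have hn1 : 1 ≤ n := by omega
    calc (n + 2) ^ c ≤ (n * n) ^ c := Nat.pow_le_pow_left h1 c
      _ = n ^ (2 * c) := by rw [← pow_two, ← pow_mul]
      _ ≤ n ^ (2 * c + 3 ^ c) := Nat.pow_le_pow_right hn1 (Nat.le_add_right _ _)
      _ ≤ n ^ (2 * c + 3 ^ c) + (2 * c + 3 ^ c) := Nat.le_add_right _ _

/-- **Target ⇒ crux** (so, with the proved `CruxToTarget`, crux ⟺ target): a family with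
poly degree and poly MONOTONE complexity is a nonnegative VP family. -/
theorem target_implies_crux (hX : NonnegRestorationQP) : MonotoneRestorationQP := by
  intro f hsymm hmono
  obtain ⟨c, hc⟩ := hmono
  refine hX f hsymm ⟨⟨⟨2, fun n => ?_⟩, ⟨2 * c + 3 ^ c, fun n => ?_⟩⟩, ⟨2 * c + 3 ^ c, fun n => ?_⟩⟩
  · simp only [Fintype.card_prod, Fintype.card_fin]
    nlinarith
  · calc (MvPolynomial.map (Complex.ofRealHom.comp NNReal.toRealHom) (f n)).totalDegree
        ≤ (f n).totalDegree := Finset.sup_mono (support_map_subset _ _)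
      _ ≤ (n + 2) ^ c := (hc n).1
      _ ≤ n ^ (2 * c + 3 ^ c) + (2 * c + 3 ^ c) := pow_succ_two_bound n c
  · calc complexity (MvPolynomial.map (Complex.ofRealHom.comp NNReal.toRealHom) (f n))
        ≤ complexity (f n) := ArithCircuit.complexity_map_le _ _
      _ ≤ (n + 2) ^ c := (hc n).2
      _ ≤ n ^ (2 * c + 3 ^ c) + (2 * c + 3 ^ c) := pow_succ_two_bound n c

/-! ### Card `row-multilinear-waring` -/

/-- Row-multilinear ("function polynomial") slice: every monomial has degree exactly one in
every row. Contains `per`, `Π_i R_i`, `F ± ε·per`, `F − per`. -/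
def IsRowMultilinear {ι κ R : Type*} [CommSemiring R] [DecidableEq ι]
    (f : MvPolynomial (ι × κ) R) : Prop :=
  ∀ m ∈ f.support, ∀ i : ι, (m.sum fun p e => if p.1 = i then e else 0) = 1

/-- The crux restricted to the row-multilinear slice (first target of the Waring line). -/
def RowMultilinearRestorationQP : Prop :=
  ∀ f : (n : ℕ) → MvPolynomial (Fin n × Fin n) NNReal,
    (∀ n, IsRowMultilinear (f n)) →
    (∀ (n : ℕ) (σ τ : Equiv.Perm (Fin n)),
      MvPolynomial.rename (fun p : Fin n × Fin n => (σ p.1, τ p.2)) (f n) = f n) →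
    (∃ c : ℕ, ∀ n : ℕ, (f n).totalDegree ≤ (n + 2) ^ c ∧
      complexity (k := NNReal) (f n) ≤ (n + 2) ^ c) →
    ∃ c : ℕ, ∀ n : ℕ, ∃ (G : Type) (_ : Fintype G)
      (C : LabelledArithCircuit ℂ (Fin n × Fin n) Unit G),
      C.IsSymmetric (Equiv.Perm (Fin n)) ∧
      C.eval (C.output ()) = MvPolynomial.map (Complex.ofRealHom.comp NNReal.toRealHom) (f n) ∧
      Fintype.card G ≤ 2 ^ ((Nat.log 2 n + c) ^ c)

/-- The monomial `∏_{i<k} x_{i, a i} · ∏_{j<l} x_{k+j, b j}` of a `(k+l) × m` matrix. -/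
def alignedMono {k l m : ℕ} (a : Fin k → Fin m) (b : Fin l → Fin m) : (Fin (k + l) × Fin m) →₀ ℕ :=
  (∑ i : Fin k, Finsupp.single (Fin.castAdd l i, a i) 1) +
    ∑ j : Fin l, Finsupp.single (Fin.natAdd k j, b j) 1

/-- Aligned flattening (catalecticant) matrix of `f` at the row cut `{0..k-1} | {k..k+l-1}`:
rows indexed by the top half-function `a`, columns by the bottom half-function `b`,
entry = coefficient of the glued monomial. -/
def alignedMatrix {k l m : ℕ} (f : MvPolynomial (Fin (k + l) × Fin m) NNReal) :
    Matrix (Fin k → Fin m) (Fin l → Fin m) ℝ :=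
  fun a b => ((f.coeff (alignedMono a b) : NNReal) : ℝ)

/-- **AlignedRankQP** (card `row-multilinear-waring`, monotone-side stub, CONJECTURAL): on the
slice, poly monotone complexity + `S_{k+l} × S_m`-invariance force quasi-polynomial rank of
every aligned flattening. (Trivially false off the slice: `Π_i R_i · Π_j C_j`.) -/
def AlignedRankQP : Prop :=
  ∀ c : ℕ, ∃ c' : ℕ, ∀ (k l m : ℕ) (f : MvPolynomial (Fin (k + l) × Fin m) NNReal),
    IsRowMultilinear f →
    (∀ (σ : Equiv.Perm (Fin (k + l))) (τ : Equiv.Perm (Fin m)),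
      MvPolynomial.rename (fun p : Fin (k + l) × Fin m => (σ p.1, τ p.2)) f = f) →
    complexity (k := NNReal) f ≤ (k + l + m + 2) ^ c →
    (alignedMatrix f).rank ≤ 2 ^ ((Nat.log 2 (k + l + m) + c') ^ c')

/-! ### Card `noninjective-core` -/

open Classical in
/-- The non-injective core `N_n = Π_i (Σ_j x_ij) − per_n = Σ_{σ : [n] → [n] not injective} x^σ`,
with its honest 0/1 coefficients over ℝ≥0. -/
def nonInjPoly (n : ℕ) : MvPolynomial (Fin n × Fin n) NNReal :=
  ∑ σ ∈ (Finset.univ.filter fun σ : Fin n → Fin n => ¬ Function.Injective σ),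
    ∏ i : Fin n, MvPolynomial.X (i, σ i)

/-- `N_n` has superpolynomial monotone complexity (the OBSTRUCTION stub of the card; beyond every
one-level rectangle-measure method, since `supp N_n` is a union of `n` `N`-dominated rectangles
at every balanced row cut). -/
def NonInjMonotoneSuperpoly : Prop :=
  ¬ ∃ c : ℕ, ∀ n : ℕ, complexity (k := NNReal) (nonInjPoly n) ≤ (n + 2) ^ c

/-- PROVABLE NOW (symmetric surgery + Dawar–Wilsenach 7.1): the crux forces `N_n` to be
monotone-hard — so `N_n` monotone-easy would REFUTE the crux. -/
def CruxForcesNonInjHard : Prop :=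
  MonotoneRestorationQP → NonInjMonotoneSuperpoly

/-- Conjectured strong form: exponential monotone complexity of the non-injective core. -/
def NonInjMonotoneExp : Prop :=
  ∃ ε : ℝ, 0 < ε ∧ ∃ᶠ n : ℕ in Filter.atTop,
    (2 : ℝ) ^ (ε * n) ≤ (complexity (k := NNReal) (nonInjPoly n) : ℝ)

/-! ### Card `ck-fooling-lift` -/

/-- The bipartite graph of a 0/1 matrix on `Fin n ⊕ Fin n`. -/
def bipGraph {n : ℕ} (A : Fin n × Fin n → Bool) : SimpleGraph (Fin n ⊕ Fin n) :=
  SimpleGraph.fromRel fun u v => ∃ i j : Fin n, u = Sum.inl i ∧ v = Sum.inr j ∧ A (i, j) = true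

/-- Evaluation of `f` at a 0/1 matrix. -/
def evalBool {n : ℕ} (A : Fin n × Fin n → Bool) (f : MvPolynomial (Fin n × Fin n) NNReal) : NNReal :=
  MvPolynomial.eval (fun p => if A p then (1 : NNReal) else 0) f

/-- **MonotoneCkFooling** (card `ck-fooling-lift`, CONJECTURAL = "monotone circuits have polylog
counting width", a NECESSARY consequence of the crux by Dawar–Wilsenach Thms 5.1/6.4):
`C^{polylog}`-equivalent 0/1 matrices are not distinguished by invariant polynomials of poly
degree and poly MONOTONE complexity. -/
def MonotoneCkFooling : Prop :=
  ∀ c : ℕ, ∃ c' : ℕ, ∀ (n : ℕ) (f : MvPolynomial (Fin n × Fin n) NNReal),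
    (∀ σ τ : Equiv.Perm (Fin n),
      MvPolynomial.rename (fun p : Fin n × Fin n => (σ p.1, τ p.2)) f = f) →
    f.totalDegree ≤ (n + 2) ^ c →
    complexity (k := NNReal) f ≤ (n + 2) ^ c →
    ∀ A B : Fin n × Fin n → Bool,
      Literature.ModelTheory.FiniteModelTheory.CkEquiv ((Nat.log 2 n + c') ^ c')
        (bipGraph A) (bipGraph B) →
      evalBool A f = evalBool B f

end Summit.ValiantsHypothesis.ValiantsHypothesis.Cruxes.MonotoneRestorationQP.Sketch

end
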